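import Literature.NumberTheory.LFunctions.PrimitiveQuadraticCharacterKronecker
import HarnessLib

/-!
# An even primitive quadratic Dirichlet character mod `q` is the Kronecker symbol `(q/·)`

Topic `Literature/NumberTheory/LFunctions`, namespace
`Literature.NumberTheory.LFunctions.PrimitiveQuadratic` (continuing
`PrimitiveQuadraticCharacterKronecker.lean`, which treats the ODD characters). Everything here is
PROVED (theorems only, no definitions, no named facts).

The classical theorem "the real primitive characters are exactly the Kronecker symbols `(D/·)` of
the fundamental discriminants `D`, with `χ(−1) = sign D`" (Davenport, *Multiplicative Number
Theory*, Ch. 5; Montgomery–Vaughan, *Multiplicative Number Theory I*, §9.3, Theorem 9.13) for the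
EVEN characters (`χ(−1) = 1`, `D = +q > 0`, real quadratic fields), by the same CRT analysis as
the odd case of the companion file:

* `mod_four_eq_three_of_level_four_mul_of_even`, `crtFst_three_eq_neg_of_level_eight_mul_of_even`
  — parity constraints: an even primitive quadratic character mod `4m` (`m` odd) has `m ≡ 3
  (mod 4)`; mod `8m` its component `χ₂` mod `8` has `χ₂(3) = −χ₄(m)`;
* `apply_natCast_eq_jacobiSym_of_even` — **for `χ` primitive, quadratic and even mod `q` and
  every odd `n`: `χ(n) = (q/n)`** (Jacobi symbol);
* `isFundamentalDiscriminant_of_even` — **`q` is a (positive) fundamental discriminant** when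
  `q > 1`: `q ≡ 1 (mod 4)` squarefree, or `q = 4m'` with `m' ≡ 2, 3 (mod 4)` squarefree;
* `apply_natCast_eq_jacobiSym_sign_mul`, `isFundamentalDiscriminant_sign_mul` — both parities at
  once: with `D = χ(−1) q` (`= ±q`), `χ(n) = (D/n)` for odd `n` and `D` is a fundamental
  discriminant (`q > 1`).

## References

* [MontgomeryVaughan2007] H. L. Montgomery, R. C. Vaughan, *Multiplicative Number Theory I*, CUP
  2007, §9.3, Theorem 9.13 (and Lemma 9.3 for the CRT decomposition).
* H. Davenport, *Multiplicative Number Theory*, 3rd ed., GTM 74 (2000), Ch. 5.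
-/

noncomputable section

open DirichletCharacter Finset
open scoped NumberTheorySymbols

namespace Literature.NumberTheory.LFunctions.PrimitiveQuadratic

/-! ### Parity constraints for even characters mod `4m` and `8m` -/

section TwoPowMul

variable {m : ℕ} [NeZero m]

/-- **Parity for `q = 4m`**: an even primitive quadratic character mod `4m`, `m` odd, has
`m ≡ 3 (mod 4)` (`1 = χ(−1) = χ₄(−1) χ₄(m) = −χ₄(m)`). [cite: MontgomeryVaughan2007, Theorem 9.13] -/
theorem mod_four_eq_three_of_level_four_mul_of_even (hm : Odd m)
    {χ : DirichletCharacter ℂ (2 ^ 2 * m)} (hprim : χ.IsPrimitive) (hquad : χ.IsQuadratic)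
    (heven : χ.Even) : m % 4 = 3 := by
  have hcop := coprime_two_pow_of_odd 2 hm
  have heven' : χ (-1) = 1 := heven
  have h3 : crtFst hcop χ (-1) = -1 := by
    rw [show (-1 : ZMod (2 ^ 2)) = (3 : ZMod 4) by decide]
    exact apply_three_of_isPrimitive_four (isPrimitive_crtFst hcop hprim)
      (IsQuadratic.crtFst hcop hquad)
  have hdec1 := apply_neg_one_eq_crtFst_mul_χ₄ hm hprim hquad
  rw [heven', h3, χ₄_cast_eq_ite hm] at hdec1
  by_contra hne
  have hm1 : m % 4 = 1 := by have := Nat.odd_iff.mp hm; omega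
  rw [if_pos hm1] at hdec1
  norm_num at hdec1

/-- **Parity for `q = 8m`**: an even primitive quadratic character mod `8m`, `m` odd, has
`χ₂(3) = −χ₄(m)` for its component `χ₂` mod `8` (`1 = χ(−1) = χ₂(7) χ₄(m) = −χ₂(3) χ₄(m)`).
[cite: MontgomeryVaughan2007, Theorem 9.13] -/
theorem crtFst_three_eq_neg_of_level_eight_mul_of_even (hm : Odd m)
    {χ : DirichletCharacter ℂ (2 ^ 3 * m)} (hprim : χ.IsPrimitive) (hquad : χ.IsQuadratic)
    (heven : χ.Even) :
    crtFst (coprime_two_pow_of_odd 3 hm) χ (3 : ZMod (2 ^ 3)) = -(ZMod.χ₄ m : ℂ) := by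
  have hcop := coprime_two_pow_of_odd 3 hm
  have heven' : χ (-1) = 1 := heven
  have hp₂ := isPrimitive_crtFst hcop hprim
  have hq₂ := IsQuadratic.crtFst hcop hquad
  have h7 : crtFst hcop χ (-1) = -crtFst hcop χ (3 : ZMod (2 ^ 3)) := by
    rw [show (-1 : ZMod (2 ^ 3)) = ((7 : ℕ) : ZMod 8) by decide,
      apply_natCast_eight_eq hp₂ hq₂ (by decide : _root_.Odd 7)]
    norm_num
  have hdec1 := apply_neg_one_eq_crtFst_mul_χ₄ hm hprim hquad
  rw [heven', h7, χ₄_cast_eq_ite hm] at hdec1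
  rw [χ₄_cast_eq_ite hm]
  have h3u : IsUnit (3 : ZMod (2 ^ 3)) := by decide
  rcases apply_eq_one_or_neg_one_of_isUnit hq₂ h3u with h | h
  · rw [h] at hdec1 ⊢
    by_cases hm4 : m % 4 = 1
    · rw [if_pos hm4] at hdec1
      norm_num at hdec1
    · rw [if_neg hm4]
      norm_num
  · rw [h] at hdec1 ⊢
    by_cases hm4 : m % 4 = 1
    · rw [if_pos hm4]
    · rw [if_neg hm4] at hdec1
      norm_num at hdec1

end TwoPowMul

/-! ### The main theorem for even characters -/

/-- **An even primitive quadratic character mod `q` is the Kronecker symbol `(q/·)` at odd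
arguments**: for `χ` primitive, quadratic (`χ(a) ∈ {0, ±1}`) and even (`χ(−1) = 1`) modulo `q`,
and every odd natural number `n`, `χ(n) = (q/n)` (Jacobi symbol). Cases: `q` odd (then `q ≡ 1
(mod 4)` is squarefree — or `q = 1` — and `χ = (·/q) = (q/·)` by reciprocity); `q = 4m`, `m` odd
(then `χ = χ₄ ⊗ (·/m)` with `m ≡ 3 (mod 4)` by parity, and `(m/n) = χ₄(n) (n/m)`); `q = 8m`,
`m` odd (then `χ = χ₂ ⊗ (·/m)` with `χ₂ = χ₈` if `m ≡ 1`, `χ₂ = χ₄χ₈` if `m ≡ 3 (mod 4)`, by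
parity); other `q` carry no primitive quadratic character. This is Montgomery–Vaughan's Theorem
9.13 for `d = q > 0`. [cite: MontgomeryVaughan2007, Theorem 9.13] -/
theorem apply_natCast_eq_jacobiSym_of_even {q : ℕ} [NeZero q] {χ : DirichletCharacter ℂ q}
    (hprim : χ.IsPrimitive) (hquad : χ.IsQuadratic) (heven : χ.Even) {n : ℕ} (hn : Odd n) :
    χ (n : ZMod q) = (J((q : ℤ) | n) : ℂ) := by
  obtain ⟨k, m, hm, hq⟩ := Nat.exists_eq_two_pow_mul_odd (NeZero.ne q)
  subst hq
  have hm0 : m ≠ 0 := fun h => by simp [h] at hm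
  haveI : NeZero m := ⟨hm0⟩
  have hm2 : m % 2 = 1 := Nat.odd_iff.mp hm
  have hn2 : n % 2 = 1 := Nat.odd_iff.mp hn
  have hk3 : k ≤ 3 := le_three_of_level_two_pow_mul hm hprim hquad
  have hcop := coprime_two_pow_of_odd k hm
  interval_cases k
  · -- `q = m` odd
    have hoddq : _root_.Odd (2 ^ 0 * m : ℕ) := by simpa using hm
    have hsq := squarefree_of_isPrimitive_of_isQuadratic hoddq hprim hquad
    rcases Nat.lt_or_ge 1 (2 ^ 0 * m) with h1 | h1
    · have hq1 := mod_four_eq_one_of_even hoddq h1 hprim hquad heven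
      rw [apply_natCast_eq_jacobiSym hoddq hsq χ hprim hquad n,
        jacobiSym.quadratic_reciprocity_one_mod_four' hn hq1]
    · have hm1 : m = 1 := by
        have := NeZero.pos m
        simp only [pow_zero, one_mul] at h1
        omega
      subst hm1
      have hsub : Subsingleton (ZMod (2 ^ 0 * 1)) := by
        rw [show 2 ^ 0 * 1 = 1 by norm_num]
        infer_instance
      rw [@Subsingleton.elim _ hsub ((n : ℕ) : ZMod (2 ^ 0 * 1)) 1, map_one]
      norm_num [jacobiSym.one_left]
  · exact (not_isPrimitive_two_mul hm hprim).elim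
  · -- `q = 4m`: `χ₂ = χ₄`, `m ≡ 3 (mod 4)`
    have hm3 := mod_four_eq_three_of_level_four_mul_of_even hm hprim hquad heven
    rw [apply_natCast_eq_crtFst_mul_jacobiSym hm hprim hquad n,
      show ((n : ℕ) : ZMod (2 ^ 2)) = ((n : ℕ) : ZMod 4) from rfl,
      apply_natCast_four_eq (isPrimitive_crtFst hcop hprim) (IsQuadratic.crtFst hcop hquad) hn,
      show (((2 ^ 2 * m : ℕ)) : ℤ) = 4 * (m : ℤ) by push_cast; ring, jacobiSym.mul_left,
      jacobiSym.at_four hn, one_mul, jacobiSym.quadratic_reciprocity' hm hn, qrSign_eq_ite hm hn,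
      if_neg (by omega), jacobiSym.at_neg_one hn, ZMod.χ₄_nat_eq_if_mod_four, if_neg (by omega)]
    have h8 : n % 8 = 1 ∨ n % 8 = 3 ∨ n % 8 = 5 ∨ n % 8 = 7 := by omega
    rcases h8 with h | h | h | h
    · have h4 : n % 4 = 1 := by omega
      simp [h, h4]
    · have h4 : n % 4 = 3 := by omega
      simp [h, h4]
    · have h4 : n % 4 = 1 := by omega
      simp [h, h4]
    · have h4 : n % 4 = 3 := by omega
      simp [h, h4]
  · -- `q = 8m`: `χ₂(3) = -χ₄(m)`
    have hε := crtFst_three_eq_neg_of_level_eight_mul_of_even hm hprim hquad heven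
    rw [apply_natCast_eq_crtFst_mul_jacobiSym hm hprim hquad n,
      show ((n : ℕ) : ZMod (2 ^ 3)) = ((n : ℕ) : ZMod 8) from rfl,
      apply_natCast_eight_eq (isPrimitive_crtFst hcop hprim) (IsQuadratic.crtFst hcop hquad) hn,
      show (3 : ZMod 8) = (3 : ZMod (2 ^ 3)) from rfl, hε, χ₄_cast_eq_ite hm,
      show (((2 ^ 3 * m : ℕ)) : ℤ) = 2 * (4 * (m : ℤ)) by push_cast; ring, jacobiSym.mul_left,
      jacobiSym.mul_left, jacobiSym.at_four hn, one_mul, jacobiSym.at_two hn,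
      jacobiSym.quadratic_reciprocity' hm hn, qrSign_eq_ite hm hn, ZMod.χ₈_nat_eq_if_mod_eight]
    have h8 : n % 8 = 1 ∨ n % 8 = 3 ∨ n % 8 = 5 ∨ n % 8 = 7 := by omega
    by_cases hm4 : m % 4 = 1 <;> rcases h8 with h | h | h | h <;> simp [h, hm4, hn2]

/-- **At an odd prime `p`: `χ(p) = (q/p)`** (Legendre symbol), for `χ` primitive, quadratic and
even mod `q`. [cite: MontgomeryVaughan2007, Theorem 9.13] -/
theorem apply_prime_eq_legendreSym_of_even {q : ℕ} [NeZero q] {χ : DirichletCharacter ℂ q}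
    (hprim : χ.IsPrimitive) (hquad : χ.IsQuadratic) (heven : χ.Even) (p : ℕ) [Fact p.Prime]
    (hp2 : p ≠ 2) : χ (p : ZMod q) = (legendreSym p (q : ℤ) : ℂ) := by
  rw [apply_natCast_eq_jacobiSym_of_even hprim hquad heven ((Fact.out : p.Prime).odd_of_ne_two hp2),
    jacobiSym.legendreSym.to_jacobiSym]

/-! ### `q` is a fundamental discriminant -/

/-- **The modulus of an even primitive quadratic character (`q > 1`) is a positive fundamental
discriminant**: either `q ≡ 1 (mod 4)` is squarefree, or `q = 4m'` with `m' ≡ 2, 3 (mod 4)`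
squarefree (i.e. `q = 4m`, `m ≡ 3 (mod 4)` squarefree, or `q = 8m`, `m` odd squarefree) — the
condition `IsFundamentalDiscriminant q` of `QuadraticFields/FundamentalDiscriminant.lean`, spelled
out. (For `q = 1` the trivial character is primitive, quadratic and even, and `1` is not a
fundamental discriminant.) [cite: MontgomeryVaughan2007, Theorem 9.13] -/
theorem isFundamentalDiscriminant_of_even {q : ℕ} [NeZero q] {χ : DirichletCharacter ℂ q}
    (hprim : χ.IsPrimitive) (hquad : χ.IsQuadratic) (heven : χ.Even) (h1 : 1 < q) :
    ((q : ℤ) % 4 = 1 ∧ Squarefree (q : ℤ) ∧ (q : ℤ) ≠ 1) ∨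
      (4 ∣ (q : ℤ) ∧ ((q : ℤ) / 4 % 4 = 2 ∨ (q : ℤ) / 4 % 4 = 3) ∧ Squarefree ((q : ℤ) / 4)) := by
  obtain ⟨k, m, hm, hq⟩ := Nat.exists_eq_two_pow_mul_odd (NeZero.ne q)
  subst hq
  have hm0 : m ≠ 0 := fun h => by simp [h] at hm
  haveI : NeZero m := ⟨hm0⟩
  have hm2 : m % 2 = 1 := Nat.odd_iff.mp hm
  have hk3 : k ≤ 3 := le_three_of_level_two_pow_mul hm hprim hquad
  have hmsq : Squarefree m := squarefree_of_level_two_pow_mul hm hprim hquad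
  have hmsqZ : Squarefree (m : ℤ) := by rwa [← Int.squarefree_natAbs, Int.natAbs_natCast]
  interval_cases k
  · left
    have hoddq : _root_.Odd (2 ^ 0 * m : ℕ) := by simpa using hm
    have hq1 := mod_four_eq_one_of_even hoddq h1 hprim hquad heven
    simp only [pow_zero, one_mul] at hq1 h1 ⊢
    refine ⟨by omega, ?_, by omega⟩
    rwa [← Int.squarefree_natAbs, Int.natAbs_natCast]
  · exact (not_isPrimitive_two_mul hm hprim).elim
  · right
    have hm3 := mod_four_eq_three_of_level_four_mul_of_even hm hprim hquad heven
    have e : ((((2 ^ 2 * m : ℕ)) : ℤ)) / 4 = (m : ℤ) := by push_cast; omega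
    refine ⟨⟨(m : ℤ), by push_cast; ring⟩, ?_, ?_⟩
    · rw [e]; omega
    · rw [e]
      exact hmsqZ
  · right
    have e : ((((2 ^ 3 * m : ℕ)) : ℤ)) / 4 = 2 * (m : ℤ) := by push_cast; omega
    refine ⟨⟨2 * (m : ℤ), by push_cast; ring⟩, ?_, ?_⟩
    · rw [e]; omega
    · rw [e, ← Int.squarefree_natAbs, show (2 * (m : ℤ)).natAbs = 2 * m by
        rw [Int.natAbs_mul]; simp]
      rw [Nat.squarefree_mul (Nat.coprime_two_left.mpr hm)]
      exact ⟨Nat.prime_two.prime.squarefree, hmsq⟩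

/-! ### Both parities: `D = χ(−1) q` -/

/-- The sign `χ(−1) ∈ {1, −1}` of a quadratic character as an integer: `χ(−1) = ((s : ℤ) : ℂ)`
with `s = 1` (`χ` even) or `s = −1` (`χ` odd). [folklore] -/
theorem exists_sign_eq {q : ℕ} [NeZero q] (χ : DirichletCharacter ℂ q) :
    ∃ s : ℤ, (s = 1 ∧ χ.Even ∨ s = -1 ∧ χ.Odd) ∧ χ (-1) = (s : ℂ) := by
  rcases χ.even_or_odd with h | h
  · exact ⟨1, Or.inl ⟨rfl, h⟩, by rw [Int.cast_one]; exact h⟩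
  · exact ⟨-1, Or.inr ⟨rfl, h⟩, by rw [Int.cast_neg, Int.cast_one]; exact h⟩

/-- **A primitive quadratic character mod `q` is the Kronecker symbol `(D/·)`, `D = χ(−1) q`, at
odd arguments** (both parities: `apply_natCast_eq_jacobiSym_of_even` and the companion file's
`apply_natCast_eq_jacobiSym_neg_of_odd`). Here `s = χ(−1) = ±1` is given as an integer.
[cite: MontgomeryVaughan2007, Theorem 9.13] -/
theorem apply_natCast_eq_jacobiSym_sign_mul {q : ℕ} [NeZero q] {χ : DirichletCharacter ℂ q}
    (hprim : χ.IsPrimitive) (hquad : χ.IsQuadratic) {s : ℤ} (hs : χ (-1) = (s : ℂ))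
    (hs1 : s = 1 ∨ s = -1) {n : ℕ} (hn : Odd n) :
    χ (n : ZMod q) = (J(s * q | n) : ℂ) := by
  rcases hs1 with rfl | rfl
  · have heven : χ.Even := by
      have h := hs
      rw [Int.cast_one] at h
      exact h
    rw [one_mul, apply_natCast_eq_jacobiSym_of_even hprim hquad heven hn]
  · have hodd : χ.Odd := by
      have h := hs
      rw [Int.cast_neg, Int.cast_one] at h
      exact h
    rw [neg_one_mul, apply_natCast_eq_jacobiSym_neg_of_odd hprim hquad hodd hn]

/-- **`D = χ(−1) q` is a fundamental discriminant** for a primitive quadratic character `χ` mod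
`q > 1` (both parities: `isFundamentalDiscriminant_of_even` and the companion file's
`isFundamentalDiscriminant_neg`): the dictionary "primitive quadratic characters ↔ fundamental
discriminants" of Montgomery–Vaughan, Thm. 9.13, in the direction character ↦ discriminant.
[cite: MontgomeryVaughan2007, Theorem 9.13] -/
theorem isFundamentalDiscriminant_sign_mul {q : ℕ} [NeZero q] {χ : DirichletCharacter ℂ q}
    (hprim : χ.IsPrimitive) (hquad : χ.IsQuadratic) {s : ℤ} (hs : χ (-1) = (s : ℂ))
    (hs1 : s = 1 ∨ s = -1) (h1 : 1 < q) :
    ((s * q : ℤ) % 4 = 1 ∧ Squarefree (s * q : ℤ) ∧ (s * q : ℤ) ≠ 1) ∨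
      (4 ∣ (s * q : ℤ) ∧ ((s * q : ℤ) / 4 % 4 = 2 ∨ (s * q : ℤ) / 4 % 4 = 3) ∧
        Squarefree ((s * q : ℤ) / 4)) := by
  rcases hs1 with rfl | rfl
  · have heven : χ.Even := by
      have h := hs
      rw [Int.cast_one] at h
      exact h
    rw [one_mul]
    exact isFundamentalDiscriminant_of_even hprim hquad heven h1
  · have hodd : χ.Odd := by
      have h := hs
      rw [Int.cast_neg, Int.cast_one] at h
      exact h
    rw [neg_one_mul]
    exact isFundamentalDiscriminant_neg hprim hquad hodd

end Literature.NumberTheory.LFunctions.PrimitiveQuadratic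

end
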